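import Literature.AlgebraicGeometry.GroupSchemes.CartierDualDoubleAnnihilator
import Literature.AlgebraicGeometry.GroupSchemes.CartierDualAnnihilatorBaseChange
import Literature.AlgebraicGeometry.GroupSchemes.FiniteGroupSchemeKernelRank
import HarnessLib

/-!
# The quotient `G⧸H := (H^⊥)^D` of a finite commutative group scheme by a subgroup, by Cartier duality (Tate 1997 §(3.7)–(3.8))

Layer `Literature/AlgebraicGeometry/GroupSchemes`, namespace `Literature.AlgebraicGeometry.GroupSchemes.AffineGroupScheme` (continues ★
`CartierDualAnnihilator` p845459 — `annihilator j = H^⊥ := ker (j^D)`, `annihilatorι` —, ★ `CartierDualBidual(Natural)` p845413 ∕ p845987 ∕ p846030 —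
`cartierDualBidualIso G : (G^D)^D ≅ G` natural in `G`, `cartierDualMap_injective`, `cartierDualMap_of_eq_one` —, ★ `CartierDualDoubleAnnihilator` p846174
(A-p06 (g30)) — `isCommMonObj_annihilator`, `finite_alg_annihilator`, `exists_iso_annihilator_annihilatorι` («`(H^⊥)^⊥ = ε_G⁻¹(H)`») —, ★
`CartierDualAnnihilatorRank` p845797 — `finrank_alg_annihilator_mul_finrank`, `injective_transpose_of_isClosedImmersion` — and ★
`CartierDualAnnihilatorBaseChange` p846227 — `GroupSchemeKernel.kerIsoOfSq` — and ★ `FiniteGroupSchemeKernelRank` — `flat_left_of_comap_injective`,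
`surjective_left_of_comap_injective`).  One `abbrev` (`quot j`), three `def`s with bodies (`quotProj`,
`quotDescDual`, `quotDesc`), instances ONLY on the lineage's own carriers ∕ morphisms (`annihilator j` — three ★ theorems registered so that `(H^⊥)^D` and
`(H^⊥)^⊥` elaborate by instance search —, `quotProj j`, `quotDescDual`, `quotDesc`), theorems; no notation, no named fact, no `sorry`.  Cell
`hodgecm-mathlib` (D-0151), programme P6 «MOD», organ (Q) of B-p04 (g38) (P6a desk «BLOCK-QUOT» ∕ D4 (a) «`𝒢_{quotΩ y L} ≅ 𝒢_y ⁄ H_L`»; F0P6c-plan's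
D3 files phrase «`φ` kills `V(I)`» for want of `G⧸V(I)`).  Count-neutral Mathlib-side capital: HC_CM is proved only modulo the printed citations until
rung 0 closes; nothing here bears on it.

THE PRINT ([Tate1997FiniteFlatGroupSchemes] (3.7): for a closed subgroup scheme `H ⊂ G` of a finite flat commutative group scheme the quotient `G⧸H`
exists, is finite flat of order `[G : H]`, and `0 → H → G → G⧸H → 0` is exact; §(3.8) pp. 145–146: Cartier duality `G ↦ G^D` is an exact
contravariant autoequivalence with `(G^D)^D = G`, so `(G⧸H)^D = ker (G^D → H^D) = H^⊥` and `G⧸H = (H^⊥)^D`).  The tree had NO quotient of a finite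
group scheme by a non-constant finite subgroup scheme; THIS FILE DEFINES IT BY DUALITY and proves its universal property FORMALLY from biduality,
for finite free commutative affine group objects `H`, `G`, `G′` of `SchemeOver R` (`R` any commutative ring) and a homomorphism `j : H ⟶ G`, under the
one instance hypothesis `[Module.Free R (Alg (annihilator j))]` («`H^⊥` is flat» — AUTOMATIC over a field; over a general base it is Tate's (3.7)
existence statement and is NOT proved here):

* §0 instances on ★ `annihilator j`: `IsCommMonObj`, `IsAffine (…).left`, `Module.Finite R (Alg _)` (★ theorems of p845459 ∕ p846174).
* §1 **`quot j := cartierDual (annihilator j)`** (`G⧸H := (H^⊥)^D`, an `abbrev`: all ★ `cartierDual.inst*` apply), **`quotProj j : G ⟶ quot j :=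
  ε_G⁻¹ ≫ (ι_{H^⊥})^D`** (a homomorphism), **`comp_quotProj : j ≫ quotProj j = 1`** (`H → G → G⧸H` is trivial).
* §2 UNIVERSAL PROPERTY: for a homomorphism `φ : G ⟶ G′` with `j ≫ φ = 1`: `quotDescDual j φ hφ : G′^D ⟶ H^⊥` (the ★ `kerLift` of `φ^D`, since
  `φ^D ≫ j^D = (j ≫ φ)^D = 1`), **`quotDesc j φ hφ : quot j ⟶ G′ := (quotDescDual)^D ≫ ε_{G′}`** (a homomorphism), **`quotProj_comp_quotDesc :
  quotProj j ≫ quotDesc j φ hφ = φ`**, **`quotProj_epi`** (two homomorphisms `quot j ⟶ G′` that agree after `quotProj j` are equal — faithfulness of `D`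
  and `ι_{H^⊥}` mono), `quotDesc_unique`.
* §3 over a field `k`, `j` a closed immersion: **`exists_iso_ker_quotProj : ∃ e : H ≅ ker (quotProj j), IsMonHom e.hom ∧ e.hom ≫ kerι (quotProj j) = j`**
  («`ker (G → G⧸H) = H`»: the double annihilator ★ p846174 transported by ★ `kerIsoOfSq`), **`finrank_alg_quot_mul_finrank : rk Γ(G⧸H) · rk Γ(H) = rk Γ(G)`**
  (Tate's «order `[G : H]`»), `injective_comap_quotProj` (`Γ(G⧸H) → Γ(G)` is injective), hence **`flat_quotProj_left`**, **`surjective_quotProj_left`**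
  (`G → G⧸H` is faithfully flat, ★ `FiniteGroupSchemeKernelRank`).

NOT here: flatness of `H^⊥` over a general base (Tate (3.7) ∕ Raynaud), quotients of `p`-divisible groups, base change of `G⧸H` (assemble from ★
`cartierDualBaseChangeIso` and ★ `annihilatorBaseChangeIso`).

## References
* [Tate1997FiniteFlatGroupSchemes] J. Tate, *Finite flat group schemes*, in: Modular Forms and Fermat's Last Theorem (1997), (3.7) and §(3.8) pp. 144–146.
* [GortzWedhorn2020] U. Görtz, T. Wedhorn, *Algebraic Geometry I: Schemes*, 2nd ed. (2020), Definition 4.45 (2), p. 117.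
-/

set_option autoImplicit false

-- Mathlib's `Over`/`Scheme` APIs are stated across semireducible wrappers (as in the ★ `GroupSchemes/*` files).
set_option backward.isDefEq.respectTransparency false

universe u

open CategoryTheory CategoryTheory.Limits AlgebraicGeometry MonoidalCategory CartesianMonoidalCategory TensorProduct WithConv

noncomputable section

namespace Literature.AlgebraicGeometry.GroupSchemes

namespace AffineGroupScheme

open scoped MonObj

open Literature.AlgebraicGeometry.Motives Literature.NumberTheory.DiophantineGeometry Literature.RingTheory.HopfAlgebra GroupSchemeKernel

/-! ## §0 Instances on `H^⊥` -/

section PerpInstances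

variable {R : Type u} [CommRing R] {H G : SchemeOver R}
  [GrpObj H] [IsCommMonObj H] [IsAffine H.left] [Module.Free R (Alg H)] [Module.Finite R (Alg H)]
  [GrpObj G] [IsCommMonObj G] [IsAffine G.left] [Module.Free R (Alg G)] [Module.Finite R (Alg G)]
  (j : H ⟶ G) [IsMonHom j]

/-- `H^⊥` is commutative (instance form of ★ `isCommMonObj_annihilator`, on the lineage's own carrier `annihilator j`).
[cite: Tate1997FiniteFlatGroupSchemes, §(3.8) p. 146] -/
instance annihilator.instIsCommMonObj : IsCommMonObj (annihilator j) := isCommMonObj_annihilator j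

omit [Module.Free R (Alg G)] [Module.Finite R (Alg G)] in
/-- `H^⊥` is affine (instance form of ★ `isAffine_annihilator_left`). [cite: Tate1997FiniteFlatGroupSchemes, §(3.8) p. 146] -/
instance annihilator.instIsAffineLeft : IsAffine (annihilator j).left := isAffine_annihilator_left j

/-- `Γ(H^⊥)` is a finite `R`-module (instance form of ★ `finite_alg_annihilator`). [cite: Tate1997FiniteFlatGroupSchemes, §(3.8) p. 146] -/
instance annihilator.instFiniteAlg : Module.Finite R (Alg (annihilator j)) := finite_alg_annihilator j

end PerpInstances

/-! ## §1 `G⧸H := (H^⊥)^D` and the projection `G → G⧸H` -/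

section Quot

variable {R : Type u} [CommRing R] {H G : SchemeOver R}
  [GrpObj H] [IsCommMonObj H] [IsAffine H.left] [Module.Free R (Alg H)] [Module.Finite R (Alg H)]
  [GrpObj G] [IsCommMonObj G] [IsAffine G.left] [Module.Free R (Alg G)] [Module.Finite R (Alg G)]
  (j : H ⟶ G) [IsMonHom j] [Module.Free R (Alg (annihilator j))]

/-- **The quotient `G⧸H := (H^⊥)^D`** of `G` by (the image of) `j : H → G` — the Cartier dual of the annihilator ([Tate1997FiniteFlatGroupSchemes]
§(3.8): `(G⧸H)^D = H^⊥` and `(·)^D` is an involution).  An `abbrev`, so every ★ `cartierDual.inst*` (group object, commutative, affine, `Γ` free and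
finite, finite flat structure map) applies to it.  [cite: Tate1997FiniteFlatGroupSchemes, (3.7)] -/
abbrev quot : SchemeOver R := cartierDual (annihilator j)

omit [Module.Free R (Alg (annihilator j))] in
/-- `G⧸H` IS `(H^⊥)^D`. [cite: Tate1997FiniteFlatGroupSchemes, §(3.8) p. 146] -/
theorem quot_def : quot j = cartierDual (annihilator j) := rfl

/-- **The projection `G → G⧸H`**: `G ≅ (G^D)^D → (H^⊥)^D`, the bidual isomorphism followed by the dual of the inclusion `ι : H^⊥ → G^D`.
[cite: Tate1997FiniteFlatGroupSchemes, (3.7)] -/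
def quotProj : G ⟶ quot j := (cartierDualBidualIso G).inv ≫ cartierDualMap (annihilatorι j)

omit [Module.Free R (Alg (annihilator j))] in
/-- Unfolding `quotProj`. [cite: Tate1997FiniteFlatGroupSchemes, (3.7)] -/
theorem quotProj_def : quotProj j = (cartierDualBidualIso G).inv ≫ cartierDualMap (annihilatorι j) := rfl

/-- **`G → G⧸H` is a homomorphism** (★ `isMonHom_cartierDualBidualIso_inv`, ★ `cartierDualMap.instIsMonHom`); an instance on the file's own morphism.
[cite: Tate1997FiniteFlatGroupSchemes, (3.7)] -/
instance quotProj.instIsMonHom : IsMonHom (quotProj j) := by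
  haveI := isMonHom_cartierDualBidualIso_inv G
  rw [quotProj_def]
  infer_instance

/-- **`H → G → G⧸H` is trivial: `j ≫ quotProj j = 1`** — naturality of biduality `j ≫ ε_G⁻¹ = ε_H⁻¹ ≫ (j^D)^D` (★ p845987) and
`(j^D)^D ≫ ι^D = (ι ≫ j^D)^D = 1^D = 1` (★ `cartierDualMap_comp`, ★ `annihilatorι_comp`, ★ `cartierDualMap_of_eq_one`).  [cite: Tate1997FiniteFlatGroupSchemes, (3.7)] -/
theorem comp_quotProj : j ≫ quotProj j = 1 := by
  rw [quotProj_def, ← Category.assoc, ← cartierDualBidualIso_inv_comp_cartierDualMap_cartierDualMap j, Category.assoc, ← cartierDualMap_comp,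
    cartierDualMap_of_eq_one (annihilatorι j ≫ cartierDualMap j) (annihilatorι_comp j), MonObj.comp_one]

/-- A `T`-point of `G` coming from `H` dies in `G⧸H`. [cite: Tate1997FiniteFlatGroupSchemes, (3.7)] -/
theorem comp_comp_quotProj {T : SchemeOver R} (x : T ⟶ H) : (x ≫ j) ≫ quotProj j = 1 := by
  rw [Category.assoc, comp_quotProj, MonObj.comp_one]

/-! ## §2 The universal property of `G → G⧸H` among finite free commutative group schemes -/

variable {G' : SchemeOver R} [GrpObj G'] [IsCommMonObj G'] [IsAffine G'.left] [Module.Free R (Alg G')] [Module.Finite R (Alg G')]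
  (φ : G ⟶ G') [IsMonHom φ] (hφ : j ≫ φ = 1)

omit [Module.Free R (Alg G)] [Module.Finite R (Alg G)] [Module.Free R (Alg G')] [Module.Finite R (Alg G')]
  [Module.Free R (Alg (annihilator j))] in
include hφ in
/-- `φ^D ≫ j^D = (j ≫ φ)^D = 1^D = 1`. [cite: Tate1997FiniteFlatGroupSchemes, §(3.8) p. 146] -/
theorem cartierDualMap_comp_cartierDualMap_eq_one : cartierDualMap φ ≫ cartierDualMap j = 1 := by
  rw [← cartierDualMap_comp, cartierDualMap_of_eq_one (j ≫ φ) hφ]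

omit [Module.Free R (Alg (annihilator j))] in
/-- **The dual descent `G′^D → H^⊥`**: `φ^D : G′^D → G^D` dies in `H^D`, so it factors through `H^⊥ = ker (j^D)` (★ `kerLift`).
[cite: Tate1997FiniteFlatGroupSchemes, §(3.8) p. 146] -/
def quotDescDual : cartierDual G' ⟶ annihilator j :=
  kerLift (f := cartierDualMap j) (cartierDualMap φ) (cartierDualMap_comp_cartierDualMap_eq_one j φ hφ)

omit [Module.Free R (Alg G)] [Module.Finite R (Alg G)] [Module.Free R (Alg G')] [Module.Finite R (Alg G')]
  [Module.Free R (Alg (annihilator j))] in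
/-- `quotDescDual ≫ ι = φ^D`. [cite: Tate1997FiniteFlatGroupSchemes, §(3.8) p. 146] -/
@[reassoc]
theorem quotDescDual_comp_annihilatorι : quotDescDual j φ hφ ≫ annihilatorι j = cartierDualMap φ :=
  kerLift_ι _ _

omit [Module.Free R (Alg (annihilator j))] in
/-- `quotDescDual` is a homomorphism (★ `isMonHom_kerLift`); an instance on the file's own morphism. [cite: Tate1997FiniteFlatGroupSchemes, §(3.8) p. 146] -/
instance quotDescDual.instIsMonHom : IsMonHom (quotDescDual j φ hφ) :=
  isMonHom_kerLift (f := cartierDualMap j) (cartierDualMap φ) _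

/-- **The descent `G⧸H → G′` of `φ`**: `(H^⊥)^D → (G′^D)^D ≅ G′`, the dual of `quotDescDual` followed by the bidual isomorphism.
[cite: Tate1997FiniteFlatGroupSchemes, (3.7)] -/
def quotDesc : quot j ⟶ G' := cartierDualMap (quotDescDual j φ hφ) ≫ (cartierDualBidualIso G').hom

omit [Module.Free R (Alg (annihilator j))] in
/-- Unfolding `quotDesc`. [cite: Tate1997FiniteFlatGroupSchemes, (3.7)] -/
theorem quotDesc_def : quotDesc j φ hφ = cartierDualMap (quotDescDual j φ hφ) ≫ (cartierDualBidualIso G').hom := rfl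

/-- `quotDesc` is a homomorphism; an instance on the file's own morphism. [cite: Tate1997FiniteFlatGroupSchemes, (3.7)] -/
instance quotDesc.instIsMonHom : IsMonHom (quotDesc j φ hφ) := by
  haveI := isMonHom_cartierDualBidualIso_hom G'
  rw [quotDesc_def]
  infer_instance

omit [Module.Free R (Alg (annihilator j))] in
/-- **THE UNIVERSAL PROPERTY, existence: `quotProj j ≫ quotDesc j φ hφ = φ`** — `ε_G⁻¹ ≫ ι^D ≫ ψ^D ≫ ε_{G′} = ε_G⁻¹ ≫ (ψ ≫ ι)^D ≫ ε_{G′} =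
ε_G⁻¹ ≫ (φ^D)^D ≫ ε_{G′} = φ` (★ `cartierDualMap_comp`, naturality of biduality ★ `eq_cartierDualBidualIso_inv_comp_comp_hom`).
[cite: Tate1997FiniteFlatGroupSchemes, (3.7)] -/
theorem quotProj_comp_quotDesc : quotProj j ≫ quotDesc j φ hφ = φ := by
  rw [quotProj_def, quotDesc_def, Category.assoc, ← Category.assoc (cartierDualMap (annihilatorι j)), ← cartierDualMap_comp,
    cartierDualMap_congr (quotDescDual_comp_annihilatorι j φ hφ), ← eq_cartierDualBidualIso_inv_comp_comp_hom]

omit [IsMonHom φ] in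
/-- **THE UNIVERSAL PROPERTY, uniqueness: `G → G⧸H` is an epimorphism against homomorphisms into finite free commutative group schemes** —
if `quotProj j ≫ χ₁ = quotProj j ≫ χ₂` then `χ₁ = χ₂`: dualise (★ `cartierDualMap_comp`), cancel the isomorphism `(ε_G⁻¹)^D` and the monomorphism
`(ι^D)^D ≅ ι` (★ naturality of biduality + ★ `mono_annihilatorι`), and use faithfulness ★ `cartierDualMap_injective`.  [cite: Tate1997FiniteFlatGroupSchemes, (3.7)] -/
theorem quotProj_epi (χ₁ χ₂ : quot j ⟶ G') [IsMonHom χ₁] [IsMonHom χ₂] (h : quotProj j ≫ χ₁ = quotProj j ≫ χ₂) : χ₁ = χ₂ := by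
  haveI := isMonHom_cartierDualBidualIso_inv G
  haveI := mono_annihilatorι j
  -- dualise `h`: `χᵢ^D ≫ (ι^D)^D ≫ (ε_G⁻¹)^D`
  have hd : cartierDualMap χ₁ ≫ cartierDualMap (cartierDualMap (annihilatorι j)) ≫ cartierDualMap (cartierDualBidualIso G).inv =
      cartierDualMap χ₂ ≫ cartierDualMap (cartierDualMap (annihilatorι j)) ≫ cartierDualMap (cartierDualBidualIso G).inv := by
    rw [← cartierDualMap_comp, ← cartierDualMap_comp, ← cartierDualMap_comp]
    exact cartierDualMap_congr h
  -- cancel the isomorphism `(ε_G⁻¹)^D` (it has the two-sided inverse `(ε_G)^D`)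
  have hiso : ∀ {X : SchemeOver R} (a b : X ⟶ cartierDual (cartierDual (cartierDual G))),
      a ≫ cartierDualMap (cartierDualBidualIso G).inv = b ≫ cartierDualMap (cartierDualBidualIso G).inv → a = b := by
    haveI := isMonHom_cartierDualBidualIso_hom G
    intro X a b hab
    have h2 := congrArg (· ≫ cartierDualMap (cartierDualBidualIso G).hom) hab
    simpa only [Category.assoc, ← cartierDualMap_comp, cartierDualMap_congr (cartierDualBidualIso G).hom_inv_id, cartierDualMap_id,
      Category.comp_id] using h2
  have hd' := hiso (cartierDualMap χ₁ ≫ cartierDualMap (cartierDualMap (annihilatorι j)))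
    (cartierDualMap χ₂ ≫ cartierDualMap (cartierDualMap (annihilatorι j))) (by simpa only [Category.assoc] using hd)
  -- `(ι^D)^D ≫ ε = ε ≫ ι` with `ι` mono, so `(ι^D)^D` is cancellable
  have hmono : cartierDualMap χ₁ ≫ (cartierDualBidualIso (annihilator j)).hom = cartierDualMap χ₂ ≫ (cartierDualBidualIso (annihilator j)).hom := by
    rw [← cancel_mono (annihilatorι j), Category.assoc, Category.assoc, ← cartierDualMap_cartierDualMap_comp_cartierDualBidualIso_hom,
      ← Category.assoc, ← Category.assoc, hd']
  have hdd : cartierDualMap χ₁ = cartierDualMap χ₂ := by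
    rw [← cancel_mono (cartierDualBidualIso (annihilator j)).hom]
    exact hmono
  exact cartierDualMap_injective χ₁ χ₂ hdd

/-- **Uniqueness of the descent**: a homomorphism `χ : G⧸H → G′` with `quotProj j ≫ χ = φ` IS `quotDesc j φ hφ`. [cite: Tate1997FiniteFlatGroupSchemes, (3.7)] -/
theorem quotDesc_unique (χ : quot j ⟶ G') [IsMonHom χ] (hχ : quotProj j ≫ χ = φ) : χ = quotDesc j φ hφ :=
  quotProj_epi j χ (quotDesc j φ hφ) (by rw [hχ, quotProj_comp_quotDesc])

end Quot

/-! ## §3 Over a field: `ker (G → G⧸H) = H`, the order of `G⧸H`, and `Γ(G⧸H) ↪ Γ(G)` -/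

section Field

variable {k : Type u} [Field k] {H G : SchemeOver k}
  [GrpObj H] [IsCommMonObj H] [IsAffine H.left] [Module.Finite k (Alg H)]
  [GrpObj G] [IsCommMonObj G] [IsAffine G.left] [Module.Finite k (Alg G)]
  (j : H ⟶ G) [IsMonHom j] [IsClosedImmersion j.left]

/-- **`ker (G → G⧸H) = H`** for a closed subgroup `j : H ↪ G` of a finite commutative group scheme over a field: an isomorphism of group schemes
`e : H ≅ ker (quotProj j)` OVER `G` (`e.hom ≫ ι = j`).  The double annihilator `H ≅ (H^⊥)^⊥ = ker ((ι_{H^⊥})^D)` over `ε_G⁻¹` (★ p846174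
`exists_iso_annihilator_annihilatorι`), transported along the square `quotProj j ≫ 𝟙 = ε_G⁻¹ ≫ (ι_{H^⊥})^D` (★ `kerIsoOfSq`).
[cite: Tate1997FiniteFlatGroupSchemes, (3.7)] [cite: GortzWedhorn2020, Definition 4.45 (2), p. 117] -/
theorem exists_iso_ker_quotProj : ∃ e : H ≅ ker (quotProj j), IsMonHom e.hom ∧ e.hom ≫ kerι (quotProj j) = j := by
  obtain ⟨u, hu, hfac⟩ := exists_iso_annihilator_annihilatorι j
  haveI := hu
  haveI := isMonHom_cartierDualBidualIso_inv G
  haveI : IsMonHom (Iso.refl (quot j)).hom := show IsMonHom (𝟙 _) from inferInstance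
  haveI : IsMonHom (cartierDualBidualIso G).symm.hom := show IsMonHom (cartierDualBidualIso G).inv from inferInstance
  have hcomm : quotProj j ≫ (Iso.refl (quot j)).hom = (cartierDualBidualIso G).symm.hom ≫ cartierDualMap (annihilatorι j) := by
    rw [Iso.refl_hom, Category.comp_id, Iso.symm_hom, quotProj_def]
  let sq : ker (quotProj j) ≅ annihilator (annihilatorι j) :=
    kerIsoOfSq (quotProj j) (cartierDualMap (annihilatorι j)) (cartierDualBidualIso G).symm (Iso.refl _) hcomm
  have hsq : sq.inv ≫ kerι (quotProj j) = kerι (cartierDualMap (annihilatorι j)) ≫ (cartierDualBidualIso G).symm.inv :=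
    kerIsoOfSq_inv_comp_kerι (quotProj j) (cartierDualMap (annihilatorι j)) (cartierDualBidualIso G).symm (Iso.refl _) hcomm
  haveI : IsMonHom sq.inv :=
    isMonHom_kerIsoOfSq_inv (quotProj j) (cartierDualMap (annihilatorι j)) (cartierDualBidualIso G).symm (Iso.refl _) hcomm
  refine ⟨u ≪≫ sq.symm, ?_, ?_⟩
  · change IsMonHom (u.hom ≫ sq.inv)
    infer_instance
  · change (u.hom ≫ sq.inv) ≫ kerι (quotProj j) = j
    rw [Category.assoc, hsq, Iso.symm_inv, ← annihilatorι_def, ← Category.assoc, hfac, Category.assoc, Iso.inv_hom_id, Category.comp_id]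

/-- **The order of `G⧸H`: `rk Γ(G⧸H) · rk Γ(H) = rk Γ(G)`** (★ `finrank_alg_cartierDual`: `rk (H^⊥)^D = rk H^⊥`; ★ rank clause `rk H^⊥ · rk H = rk G`).
[cite: Tate1997FiniteFlatGroupSchemes, (3.7)] -/
theorem finrank_alg_quot_mul_finrank : Module.finrank k (Alg (quot j)) * Module.finrank k (Alg H) = Module.finrank k (Alg G) := by
  rw [finrank_alg_cartierDual (annihilator j)]
  exact finrank_alg_annihilator_mul_finrank j

/-- `rk Γ(G⧸H) = rk Γ(G) ⁄ rk Γ(H)`. [cite: Tate1997FiniteFlatGroupSchemes, (3.7)] -/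
theorem finrank_alg_quot_eq_div : Module.finrank k (Alg (quot j)) = Module.finrank k (Alg G) / Module.finrank k (Alg H) := by
  rw [finrank_alg_cartierDual (annihilator j)]
  exact finrank_alg_annihilator_eq_div j

omit [IsClosedImmersion j.left] in
/-- **`Γ(G⧸H) → Γ(G)` is injective** (so `G → G⧸H` is schematically dominant): `Γ(quotProj) = Γ(ε_G⁻¹) ∘ Γ((ι_{H^⊥})^D)`, `Γ(ε_G⁻¹)` is bijective and
`Γ((ι_{H^⊥})^D)` is, up to the ★ `algCartierDualEquiv`s, the transpose of the SURJECTION `Γ(ι_{H^⊥})` (`ι_{H^⊥}` is a closed immersion; ★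
`injective_transpose_of_isClosedImmersion`, ★ `algCartierDualEquiv_comp_comap_cartierDualMap`). [cite: Tate1997FiniteFlatGroupSchemes, (3.7)] -/
theorem injective_comap_quotProj : Function.Injective (Alg.comap (quotProj j)) := by
  haveI := isClosedImmersion_annihilatorι_left j
  have hι : Function.Injective (DualAlg.transpose (annihilatorι j)) := injective_transpose_of_isClosedImmersion (annihilatorι j)
  -- `Γ(ι^D)` is injective: `e_{H^⊥} ∘ Γ(ι^D) = (transpose ι) ∘ e_{G^D}` with `e` the ★ `algCartierDualEquiv`s
  have hD : Function.Injective (Alg.comap (cartierDualMap (annihilatorι j))) := by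
    intro a b hab
    have ha := AlgHom.congr_fun (algCartierDualEquiv_comp_comap_cartierDualMap (annihilatorι j)) a
    have hb := AlgHom.congr_fun (algCartierDualEquiv_comp_comap_cartierDualMap (annihilatorι j)) b
    change algCartierDualEquiv (cartierDual G) (Alg.comap (cartierDualMap (annihilatorι j)) a) =
      DualAlg.transpose (annihilatorι j) (algCartierDualEquiv (annihilator j) a) at ha
    change algCartierDualEquiv (cartierDual G) (Alg.comap (cartierDualMap (annihilatorι j)) b) =
      DualAlg.transpose (annihilatorι j) (algCartierDualEquiv (annihilator j) b) at hb
    have hab' : DualAlg.transpose (annihilatorι j) (algCartierDualEquiv (annihilator j) a) =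
        DualAlg.transpose (annihilatorι j) (algCartierDualEquiv (annihilator j) b) := by
      rw [← ha, ← hb, hab]
    exact (algCartierDualEquiv (annihilator j)).injective (hι hab')
  -- `Γ(ε_G⁻¹)` is injective (`ε_G` is an isomorphism)
  have hε : Function.Injective (Alg.comap (cartierDualBidualIso G).inv) := by
    intro a b hab
    have hcomp : ∀ c, Alg.comap (cartierDualBidualIso G).hom (Alg.comap (cartierDualBidualIso G).inv c) = c := fun c => by
      rw [← AlgHom.comp_apply, ← Alg.comap_comp, Iso.hom_inv_id, Alg.comap_id, AlgHom.id_apply]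
    have h2 := congrArg (Alg.comap (cartierDualBidualIso G).hom) hab
    rwa [hcomp, hcomp] at h2
  rw [quotProj_def, Alg.comap_comp]
  exact hε.comp hD

omit [IsClosedImmersion j.left] in
/-- **`G → G⧸H` is FLAT** (★ `flat_left_of_comap_injective`: over a field an affine homomorphism of finite group schemes with `Γ(f)` injective is
faithfully flat, [Waterhouse1979 §14.1]). [cite: Tate1997FiniteFlatGroupSchemes, (3.7)] -/
theorem flat_quotProj_left : Flat (quotProj j).left := flat_left_of_comap_injective (quotProj j) (injective_comap_quotProj j)

omit [IsClosedImmersion j.left] in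
/-- **`G → G⧸H` is SURJECTIVE** (★ `surjective_left_of_comap_injective`). [cite: Tate1997FiniteFlatGroupSchemes, (3.7)] -/
theorem surjective_quotProj_left : Surjective (quotProj j).left :=
  surjective_left_of_comap_injective (quotProj j) (injective_comap_quotProj j)

end Field

end AffineGroupScheme

end Literature.AlgebraicGeometry.GroupSchemes

end
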